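import Summits.AtomisticToContinuum.HydrodynamicLimit.Theorems.TwoClocksEquilibriumFastWindowLDBirthT12ThalesGain
import Summits.AtomisticToContinuum.HydrodynamicLimit.Theorems.TwoClocksEquilibriumFastWindowLDBirthT12LossAsymptotics
import Literature.Analysis.UnboundedOperators.LinearizedBoltzmannKernelActionPointwise
import HarnessLib

/-!
# The true gain term of the linearised hard-sphere operator on the radial weights `1`, `‖x‖`:
# comparison with its far-field (Lorentz) limit and the weighted sup bound
# (helpers `t12_gainTerm_norm_sub_lorentz`, `t12_gainTerm_abs_le_of_linearGrowth` of the line `birth`, crux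
# `TwoClocks.EquilibriumFastWindowLD`, stmt-AtomisticToContinuum-14440; FF1 completion step 1 (w-comparison on
# the positive cone) towards the registered analytic sub-goal `t12_logLinearPreimage_and_dipoleModulus`)

Companion of `…T12Lorentz` (the far-field gain operator `lorentzGain`, partner frozen at `w = 0`, with
`lorentzGain 1 v = 2π‖v‖`, `lorentzGain ‖·‖ v = (4/3)π‖v‖²`). Here the Maxwellian partner `w ∼ M` is kept and
the TRUE gain term

  `gainTerm u v := ∫ dM(w) ∫_{S²} ((v-w)·ω)₊ u(v') dσ(ω) + ∫ dM(w) ∫_{S²} ((v-w)·ω)₊ u(w') dσ(ω)`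

(`(v', w') = collide ω (v, w)`, `M = stdGaussian`, `σ = sphereMeasure`; the first two pieces of
`kernelAction_eq_pieces_of_gaussGrowth`, so `Kψ = gainTerm ψ - K₁ψ`: `kernelAction_eq_gainTerm_sub`) is
compared with its Lorentz limit ON THE RADIAL WEIGHTS — the comparison that holds without any regularity
of `u` (for general bounded `u` no pointwise comparison can hold: the Lorentz law of the argument of `u`
lives on the Thales sphere, a Lebesgue-null set, the true law is absolutely continuous), and exactly what
the positivity bookkeeping of the `ℓ ≥ 2` scheme (plan §6) consumes:

* `gainTerm_one`: `gainTerm 1 v = 2ν(v)`, whence **`0 ≤ gainTerm 1 v - 2π‖v‖ ≤ 2√3 π`** (`ν ≥ π‖v‖`,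
  `pi_mul_norm_le_collisionFrequency`; `ν = π∫‖v-w‖dM ≤ π(‖v‖ + ∫‖w‖dM)`, `∫‖w‖dM ≤ √3`);
* **registered `t12_gainTerm_norm_sub_lorentz`: `|gainTerm ‖·‖ v - (4/3)π‖v‖²| ≤ 2π(5 + √3‖v‖)`** — per
  partner `w` the circle averages are exact, `∫ (u·ω)₊ ‖v' - w‖ dσ = ∫ (u·ω)₊ ‖w' - w‖ dσ = (2/3)π‖v-w‖²`
  (radius law `2ρ dρ`, `integral_hardSphereKernel_smul_comp_radiusFst/Snd`), `|‖v'‖ - ‖v' - w‖| ≤ ‖w‖`, so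
  `|∫ (u·ω)₊ ‖v'‖ dσ - (2/3)π‖v-w‖²| ≤ π‖v-w‖‖w‖`; then `∫‖v-w‖² dM = ‖v‖² + 3`, `∫(‖v‖‖w‖ + ‖w‖²) dM ≤ √3‖v‖ + 3`;
* **registered `t12_gainTerm_abs_le_of_linearGrowth`**: `|u(x)| ≤ m(1 + ‖x‖)` ⟹
  **`|gainTerm u v| ≤ m π ((4/3)‖v‖² + 14(1 + ‖v‖))`** (`|gainTerm u| ≤ m(gainTerm 1 + gainTerm ‖·‖)` by
  positivity). With `ν(v) ≥ π‖v‖`: `‖ν⁻¹ gainTerm‖ ≤ 4/3 + O(1/s₀)` on the weighted space `sup|u|/(1+‖v‖)`,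
  `‖v‖ ≥ s₀` — the SAME leading constant `λ₀(1) = 4/3` as the Lorentz operator (`t12_lorentzGain_abs_le`).

[folklore] (large-speed behaviour of the hard-sphere gain term: Grad 1963 §4; Cercignani–Illner–Pulvirenti 1994 §7.2).
-/

noncomputable section

open MeasureTheory ProbabilityTheory Real Set Filter Metric
open scoped ENNReal BigOperators InnerProductSpace
namespace Summit.AtomisticToContinuum.HydrodynamicLimit.Theorems.ClampedCorrectorBirth

open Literature.Analysis.FluidPDE Literature.MathematicalPhysics.KineticTheory
open Literature.Analysis.UnboundedOperators

/-! ### The gain term -/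

/-- **The gain term `K₂u(v)` of the linearised hard-sphere operator of `ℝ³`** (own piece + partner piece):
`gainTerm u v = ∫ dM(w) ∫_{S²} ((v-w)·ω)₊ u(v') dσ(ω) + ∫ dM(w) ∫_{S²} ((v-w)·ω)₊ u(w') dσ(ω)`, the first two
pieces of `kernelAction_eq_pieces_of_gaussGrowth` (CIP 1994 §7.2 (2.14)). [folklore] -/
def gainTerm (u : EuclideanSpace ℝ (Fin 3) → ℝ) (v : EuclideanSpace ℝ (Fin 3)) : ℝ :=
  (∫ w, ∫ ω, hardSphereKernel (v, w) ω * u (collide ω (v, w)).1 ∂sphereMeasure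
      ∂stdGaussian (EuclideanSpace ℝ (Fin 3))) +
    ∫ w, ∫ ω, hardSphereKernel (v, w) ω * u (collide ω (v, w)).2 ∂sphereMeasure
      ∂stdGaussian (EuclideanSpace ℝ (Fin 3))

variable {u : EuclideanSpace ℝ (Fin 3) → ℝ} {v w : EuclideanSpace ℝ (Fin 3)}

/-- **Grad's splitting through the gain term**: for `ψ` measurable of Gaussian growth,
`Kψ(v) = ∫∫ B (ψ' + ψ_*' - ψ_*) = gainTerm ψ v - K₁ψ(v)`. [folklore] -/
theorem kernelAction_eq_gainTerm_sub {ψ : EuclideanSpace ℝ (Fin 3) → ℝ} (hψ : Measurable ψ) {C : ℝ}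
    (hC : ∀ x, |ψ x| ≤ C * Real.exp (‖x‖ ^ 2 / 4)) (v : EuclideanSpace ℝ (Fin 3)) :
    ∫ w, ∫ ω, hardSphereKernel (v, w) ω * (ψ (collide ω (v, w)).1 + ψ (collide ω (v, w)).2 - ψ w)
        ∂sphereMeasure ∂stdGaussian (EuclideanSpace ℝ (Fin 3)) =
      gainTerm ψ v - ∫ w, ∫ ω, hardSphereKernel (v, w) ω * ψ w ∂sphereMeasure
        ∂stdGaussian (EuclideanSpace ℝ (Fin 3)) :=
  kernelAction_eq_pieces_of_gaussGrowth hψ hC v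

/-! ### Elementary bounds -/

/-- `((v-w)·ω)₊ ≤ ‖v - w‖`. [folklore] -/
theorem hardSphereKernel_le_norm (v w : EuclideanSpace ℝ (Fin 3)) (ω : sphere (0 : EuclideanSpace ℝ (Fin 3)) 1) :
    hardSphereKernel (v, w) ω ≤ ‖v - w‖ := by
  refine max_le ((real_inner_le_norm _ _).trans ?_) (norm_nonneg _)
  rw [norm_eq_of_mem_sphere, mul_one]

/-- Energy conservation: `‖v'‖², ‖w'‖² ≤ ‖v‖² + ‖w‖²`. [folklore] -/
theorem norm_sq_collide_le (ω : sphere (0 : EuclideanSpace ℝ (Fin 3)) 1) (v w : EuclideanSpace ℝ (Fin 3)) :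
    ‖(collide ω (v, w)).1‖ ^ 2 ≤ ‖v‖ ^ 2 + ‖w‖ ^ 2 ∧ ‖(collide ω (v, w)).2‖ ^ 2 ≤ ‖v‖ ^ 2 + ‖w‖ ^ 2 := by
  have h := norm_sq_collide_fst_add_norm_sq_collide_snd ω (v, w)
  simp only at h
  constructor <;> nlinarith [sq_nonneg ‖(collide ω (v, w)).2‖, sq_nonneg ‖(collide ω (v, w)).1‖]

/-- `‖x‖² ≤ ‖v‖² + ‖w‖² ⟹ ‖x‖ ≤ ‖v‖ + ‖w‖`. [folklore] -/
theorem norm_le_add_of_sq_le {x : EuclideanSpace ℝ (Fin 3)} (h : ‖x‖ ^ 2 ≤ ‖v‖ ^ 2 + ‖w‖ ^ 2) : ‖x‖ ≤ ‖v‖ + ‖w‖ := by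
  nlinarith [norm_nonneg x, norm_nonneg v, norm_nonneg w, mul_nonneg (norm_nonneg v) (norm_nonneg w)]

/-- `‖x‖ ≤ 1 · e^{‖x‖²/4}`: the linear weight has Gaussian growth. [folklore] -/
theorem abs_norm_le_exp_sq_div_four (x : EuclideanSpace ℝ (Fin 3)) : |‖x‖| ≤ 1 * Real.exp (‖x‖ ^ 2 / 4) := by
  rw [abs_norm, one_mul]
  have h := Real.add_one_le_exp (‖x‖ ^ 2 / 4)
  nlinarith [sq_nonneg (‖x‖ - 2)]

/-- A bounded measurable integrand is integrable on the (finite) sphere measure. [folklore] -/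
theorem integrable_sphere_of_bound {f : sphere (0 : EuclideanSpace ℝ (Fin 3)) 1 → ℝ} (hf : Measurable f) {K : ℝ}
    (hK : ∀ ω, |f ω| ≤ K) : Integrable f (sphereMeasure : Measure (sphere (0 : EuclideanSpace ℝ (Fin 3)) 1)) := by
  haveI := isFiniteMeasure_sphereMeasure (E := EuclideanSpace ℝ (Fin 3))
  exact (integrable_const K).mono' hf.aestronglyMeasurable
    (Eventually.of_forall fun ω => by rw [Real.norm_eq_abs]; exact hK ω)

/-- `∫_{S²} ((v-w)·ω)₊ dσ(ω) = π‖v - w‖` (hat-box). [folklore] -/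
theorem sphereIntegral_hardSphereKernel (v w : EuclideanSpace ℝ (Fin 3)) :
    ∫ ω, hardSphereKernel (v, w) ω ∂sphereMeasure = π * ‖v - w‖ := by
  rw [integral_congr_ae (Eventually.of_forall fun ω => hardSphereKernel_eq_sub_zero v w ω)]
  exact sphereIntegral_hardSphereKernel_zero (v - w)

/-! ### Gaussian moments -/

/-- **`∫ ‖w‖ dM ≤ √3`** and **`∫ (‖v‖‖w‖ + ‖w‖²) dM ≤ √3‖v‖ + 3`** (`2√3‖w‖ ≤ ‖w‖² + 3` pointwise, `∫‖w‖² dM = 3`),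
with the integrability of both integrands. [folklore] -/
theorem integral_norm_moments_stdGaussian_le (v : EuclideanSpace ℝ (Fin 3)) :
    Integrable (fun w : EuclideanSpace ℝ (Fin 3) => ‖w‖) (stdGaussian (EuclideanSpace ℝ (Fin 3))) ∧
      ∫ w, ‖w‖ ∂stdGaussian (EuclideanSpace ℝ (Fin 3)) ≤ Real.sqrt 3 ∧
      Integrable (fun w : EuclideanSpace ℝ (Fin 3) => ‖v‖ * ‖w‖ + ‖w‖ ^ 2) (stdGaussian (EuclideanSpace ℝ (Fin 3))) ∧
      ∫ w, (‖v‖ * ‖w‖ + ‖w‖ ^ 2) ∂stdGaussian (EuclideanSpace ℝ (Fin 3)) ≤ Real.sqrt 3 * ‖v‖ + 3 := by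
  set μ : Measure (EuclideanSpace ℝ (Fin 3)) := stdGaussian (EuclideanSpace ℝ (Fin 3)) with hμ
  have hnorm : Integrable (fun w : EuclideanSpace ℝ (Fin 3) => ‖w‖) μ :=
    ((IsGaussian.memLp_id μ 1 ENNReal.one_ne_top).integrable le_rfl).norm
  have hsq : Integrable (fun w : EuclideanSpace ℝ (Fin 3) => ‖w‖ ^ 2) μ :=
    (IsGaussian.memLp_id μ 2 (by simp)).integrable_norm_pow (by norm_num)
  have hI2 : ∫ w, ‖w‖ ^ 2 ∂μ = 3 := by
    rw [hμ, integral_norm_sq_stdGaussian, Fintype.card_fin]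
    norm_num
  have h3 : (0:ℝ) < Real.sqrt 3 := Real.sqrt_pos.2 (by norm_num)
  have h33 : Real.sqrt 3 ^ 2 = 3 := Real.sq_sqrt (by norm_num)
  have hle : 2 * Real.sqrt 3 * ∫ w, ‖w‖ ∂μ ≤ 3 + 3 := by
    rw [← integral_const_mul]
    calc ∫ w, 2 * Real.sqrt 3 * ‖w‖ ∂μ ≤ ∫ w, (‖w‖ ^ 2 + 3) ∂μ :=
          integral_mono (hnorm.const_mul _) (hsq.add (integrable_const _)) fun w => by
            nlinarith [sq_nonneg (‖w‖ - Real.sqrt 3)]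
      _ = 3 + 3 := by rw [integral_add hsq (integrable_const _), integral_const, hI2, probReal_univ, one_smul]
  have h1 : ∫ w, ‖w‖ ∂μ ≤ Real.sqrt 3 := by nlinarith
  refine ⟨hnorm, h1, (hnorm.const_mul _).add hsq, ?_⟩
  rw [integral_add (hnorm.const_mul _) hsq, integral_const_mul, hI2]
  nlinarith [norm_nonneg v]

/-! ### The weight `1`: `gainTerm 1 = 2ν` -/

/-- **`gainTerm 1 v = 2ν(v)`** (both pieces are the collision frequency). [folklore] -/
theorem gainTerm_one (v : EuclideanSpace ℝ (Fin 3)) : gainTerm (fun _ => (1:ℝ)) v = 2 * collisionFrequency v := by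
  simp only [gainTerm, mul_one, collisionFrequency]
  ring

/-- **`ν(v) ≤ π(‖v‖ + √3)`** (`ν = π∫‖v-w‖dM`, `‖v-w‖ ≤ ‖v‖ + ‖w‖`, `∫‖w‖dM ≤ √3`). [folklore] -/
theorem collisionFrequency_le_pi_mul_add (v : EuclideanSpace ℝ (Fin 3)) :
    collisionFrequency v ≤ π * (‖v‖ + Real.sqrt 3) := by
  obtain ⟨hnorm, h3, -, -⟩ := integral_norm_moments_stdGaussian_le v
  have hid : Integrable (fun w : EuclideanSpace ℝ (Fin 3) => w) (stdGaussian (EuclideanSpace ℝ (Fin 3))) :=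
    (IsGaussian.memLp_id _ 1 ENNReal.one_ne_top).integrable le_rfl
  have hle : ∫ w, ‖v - w‖ ∂stdGaussian (EuclideanSpace ℝ (Fin 3)) ≤ ‖v‖ + Real.sqrt 3 := by
    calc ∫ w, ‖v - w‖ ∂stdGaussian (EuclideanSpace ℝ (Fin 3))
        ≤ ∫ w, (‖v‖ + ‖w‖) ∂stdGaussian (EuclideanSpace ℝ (Fin 3)) :=
          integral_mono ((integrable_const v).sub hid).norm ((integrable_const _).add hnorm) fun w => norm_sub_le v w
      _ ≤ ‖v‖ + Real.sqrt 3 := by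
          rw [integral_add (integrable_const _) hnorm, integral_const, probReal_univ, one_smul]; linarith
  rw [collisionFrequency_eq_pi_mul_integral_norm_sub]
  exact mul_le_mul_of_nonneg_left hle pi_pos.le

/-- **The weight `1` against its Lorentz limit**: `0 ≤ gainTerm 1 v - 2π‖v‖ ≤ 2√3 π`
(`lorentzGain 1 v = 2π‖v‖`, file `…T12Lorentz`). [folklore] -/
theorem gainTerm_one_sub_lorentz (v : EuclideanSpace ℝ (Fin 3)) :
    0 ≤ gainTerm (fun _ => (1:ℝ)) v - 2 * π * ‖v‖ ∧
      gainTerm (fun _ => (1:ℝ)) v - 2 * π * ‖v‖ ≤ 2 * Real.sqrt 3 * π := by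
  rw [gainTerm_one]
  exact ⟨by nlinarith [pi_mul_norm_le_collisionFrequency v], by nlinarith [collisionFrequency_le_pi_mul_add v]⟩

/-! ### The weight `‖x‖`: exact circle averages of `‖v' - w‖`, `‖w' - w‖` and the thermal shift -/

/-- `∫₀¹ 2ρ · ρ s dρ = (2/3) s`. [folklore] -/
theorem integral_two_mul_mul_mul (s : ℝ) : ∫ ρ in (0:ℝ)..1, 2 * ρ * (ρ * s) = 2 / 3 * s := by
  have : (fun ρ : ℝ => 2 * ρ * (ρ * s)) = fun ρ : ℝ => 2 * s * ρ ^ 2 := by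
    funext ρ; ring
  rw [this, intervalIntegral.integral_const_mul, integral_pow]
  norm_num; ring

/-- **`∫_{S²} ((v-w)·ω)₊ ‖v' - w‖ dσ = ∫_{S²} ((v-w)·ω)₊ ‖w' - w‖ dσ = (2/3)π‖v - w‖²`** — the radius ratios of the own
and of the partner particle both have the law `2ρ dρ` under the flux measure. [folklore] -/
theorem sphereIntegral_hardSphereKernel_mul_norm_collide_sub (v w : EuclideanSpace ℝ (Fin 3)) :
    ∫ ω, hardSphereKernel (v, w) ω * ‖(collide ω (v, w)).1 - w‖ ∂sphereMeasure = 2 / 3 * π * ‖v - w‖ ^ 2 ∧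
      ∫ ω, hardSphereKernel (v, w) ω * ‖(collide ω (v, w)).2 - w‖ ∂sphereMeasure = 2 / 3 * π * ‖v - w‖ ^ 2 := by
  rcases eq_or_ne v w with rfl | hvw
  · simp [hardSphereKernel]
  have hs : ‖v - w‖ ≠ 0 := norm_ne_zero_iff.2 (sub_ne_zero.2 hvw)
  have hF : AEStronglyMeasurable (fun ρ : ℝ => ρ * ‖v - w‖) (volume.restrict (Icc (0:ℝ) 1)) :=
    (measurable_id.mul_const _).aestronglyMeasurable
  have h1 := integral_hardSphereKernel_smul_comp_radiusFst v w hF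
  have h2 := integral_hardSphereKernel_smul_comp_radiusSnd v w hF
  simp only [smul_eq_mul, div_mul_cancel₀ _ hs, integral_two_mul_mul_mul] at h1 h2
  rw [h1, h2]
  constructor <;> ring

/-- **Thermal shift of one circle average, pointwise in the partner**: for a measurable transported velocity
`V ω` with `‖V ω‖ ≤ ‖v‖ + ‖w‖` and `∫ (u·ω)₊ ‖V ω - w‖ dσ = (2/3)π‖v-w‖²` (both outgoing velocities qualify),
`|∫ (u·ω)₊ ‖V ω‖ dσ - (2/3)π‖v - w‖²| ≤ π‖v - w‖‖w‖` (`|‖V‖ - ‖V - w‖| ≤ ‖w‖`). [folklore] -/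
theorem abs_sphereIntegral_norm_sub_le {V : sphere (0 : EuclideanSpace ℝ (Fin 3)) 1 → EuclideanSpace ℝ (Fin 3)}
    (hV : Measurable V) (hVb : ∀ ω, ‖V ω‖ ≤ ‖v‖ + ‖w‖)
    (hrad : ∫ ω, hardSphereKernel (v, w) ω * ‖V ω - w‖ ∂sphereMeasure = 2 / 3 * π * ‖v - w‖ ^ 2) :
    |∫ ω, hardSphereKernel (v, w) ω * ‖V ω‖ ∂sphereMeasure - 2 / 3 * π * ‖v - w‖ ^ 2| ≤ π * ‖v - w‖ * ‖w‖ := by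
  have hBm : Measurable fun ω : sphere (0 : EuclideanSpace ℝ (Fin 3)) 1 => hardSphereKernel (v, w) ω := by
    unfold hardSphereKernel; fun_prop
  have hB0 : ∀ ω, 0 ≤ hardSphereKernel (v, w) ω := fun ω => le_max_right _ _
  have hBle : ∀ ω, hardSphereKernel (v, w) ω ≤ ‖v - w‖ := hardSphereKernel_le_norm v w
  have i1 : Integrable (fun ω => hardSphereKernel (v, w) ω * ‖V ω‖)
      (sphereMeasure : Measure (sphere (0 : EuclideanSpace ℝ (Fin 3)) 1)) := by
    refine integrable_sphere_of_bound (hBm.mul hV.norm) (K := ‖v - w‖ * (‖v‖ + ‖w‖)) fun ω => ?_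
    rw [abs_mul, abs_of_nonneg (hB0 ω), abs_norm]
    exact mul_le_mul (hBle ω) (hVb ω) (norm_nonneg _) (norm_nonneg _)
  have i2 : Integrable (fun ω => hardSphereKernel (v, w) ω * ‖V ω - w‖)
      (sphereMeasure : Measure (sphere (0 : EuclideanSpace ℝ (Fin 3)) 1)) := by
    refine integrable_sphere_of_bound (hBm.mul (hV.sub_const w).norm) (K := ‖v - w‖ * (‖v‖ + ‖w‖ + ‖w‖)) fun ω => ?_
    rw [abs_mul, abs_of_nonneg (hB0 ω), abs_norm]
    exact mul_le_mul (hBle ω) ((norm_sub_le _ _).trans (by linarith [hVb ω])) (norm_nonneg _) (norm_nonneg _)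
  have i3 : Integrable (fun ω => hardSphereKernel (v, w) ω * ‖w‖)
      (sphereMeasure : Measure (sphere (0 : EuclideanSpace ℝ (Fin 3)) 1)) :=
    (integrable_sphere_of_bound hBm (K := ‖v - w‖) fun ω => by
      rw [abs_of_nonneg (hB0 ω)]; exact hBle ω).mul_const _
  rw [← hrad, ← integral_sub i1 i2]
  calc |∫ ω, (hardSphereKernel (v, w) ω * ‖V ω‖ - hardSphereKernel (v, w) ω * ‖V ω - w‖) ∂sphereMeasure|
      ≤ ∫ ω, hardSphereKernel (v, w) ω * ‖w‖ ∂sphereMeasure := by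
        rw [← Real.norm_eq_abs]
        refine norm_integral_le_of_norm_le i3 (Eventually.of_forall fun ω => ?_)
        rw [Real.norm_eq_abs, ← mul_sub, abs_mul, abs_of_nonneg (hB0 ω)]
        refine mul_le_mul_of_nonneg_left ?_ (hB0 ω)
        have h := abs_norm_sub_norm_le (V ω) (V ω - w)
        rwa [sub_sub_cancel] at h
    _ = π * ‖v - w‖ * ‖w‖ := by rw [integral_mul_const, sphereIntegral_hardSphereKernel]

/-- **Thermal shift of one piece, integrated**: for a measurable transported velocity `P (w, ω)` (`v'` or `w'`)
with `‖P‖² ≤ ‖v‖² + ‖w‖²` and exact circle averages `∫ (u·ω)₊ ‖P - w‖ dσ = (2/3)π‖v-w‖²` for every `w`: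
`|∫ dM ∫ (u·ω)₊ ‖P‖ dσ - (2/3)π(‖v‖² + 3)| ≤ π(√3‖v‖ + 3)` (`∫‖v-w‖² dM = ‖v‖² + 3`). [folklore] -/
theorem abs_gainPiece_norm_sub_le (v : EuclideanSpace ℝ (Fin 3))
    {P : EuclideanSpace ℝ (Fin 3) × sphere (0 : EuclideanSpace ℝ (Fin 3)) 1 → EuclideanSpace ℝ (Fin 3)}
    (hPm : Measurable P) (hP : ∀ w ω, ‖P (w, ω)‖ ^ 2 ≤ ‖v‖ ^ 2 + ‖w‖ ^ 2)
    (hrad : ∀ w, ∫ ω, hardSphereKernel (v, w) ω * ‖P (w, ω) - w‖ ∂sphereMeasure = 2 / 3 * π * ‖v - w‖ ^ 2) :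
    |(∫ w, ∫ ω, hardSphereKernel (v, w) ω * ‖P (w, ω)‖ ∂sphereMeasure ∂stdGaussian (EuclideanSpace ℝ (Fin 3))) -
        2 / 3 * π * (‖v‖ ^ 2 + 3)| ≤ π * (Real.sqrt 3 * ‖v‖ + 3) := by
  obtain ⟨-, hI⟩ := integrable_kernel_mul_comp_of_gaussGrowth (ψ := fun x : EuclideanSpace ℝ (Fin 3) => ‖x‖)
    measurable_norm abs_norm_le_exp_sq_div_four v hPm hP
  have hsq : Integrable (fun w : EuclideanSpace ℝ (Fin 3) => 2 / 3 * π * ‖v - w‖ ^ 2)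
      (stdGaussian (EuclideanSpace ℝ (Fin 3))) := (memLp_two_norm_sub v).integrable_sq.const_mul _
  obtain ⟨-, -, hg, hgle⟩ := integral_norm_moments_stdGaussian_le v
  have hJ : ∫ w, 2 / 3 * π * ‖v - w‖ ^ 2 ∂stdGaussian (EuclideanSpace ℝ (Fin 3)) = 2 / 3 * π * (‖v‖ ^ 2 + 3) := by
    rw [integral_const_mul, integral_norm_sub_sq_stdGaussian]
  rw [← hJ, ← integral_sub hI hsq]
  calc |∫ w, ((∫ ω, hardSphereKernel (v, w) ω * ‖P (w, ω)‖ ∂sphereMeasure) - 2 / 3 * π * ‖v - w‖ ^ 2)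
          ∂stdGaussian (EuclideanSpace ℝ (Fin 3))|
      ≤ ∫ w, π * (‖v‖ * ‖w‖ + ‖w‖ ^ 2) ∂stdGaussian (EuclideanSpace ℝ (Fin 3)) := by
        rw [← Real.norm_eq_abs]
        refine norm_integral_le_of_norm_le (hg.const_mul π) (Eventually.of_forall fun w => ?_)
        rw [Real.norm_eq_abs]
        calc |(∫ ω, hardSphereKernel (v, w) ω * ‖P (w, ω)‖ ∂sphereMeasure) - 2 / 3 * π * ‖v - w‖ ^ 2|
            ≤ π * ‖v - w‖ * ‖w‖ := abs_sphereIntegral_norm_sub_le (hPm.comp measurable_prodMk_left)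
                (fun ω => norm_le_add_of_sq_le (hP w ω)) (hrad w)
          _ ≤ π * (‖v‖ + ‖w‖) * ‖w‖ := by gcongr; exact norm_sub_le v w
          _ = π * (‖v‖ * ‖w‖ + ‖w‖ ^ 2) := by ring
    _ ≤ π * (Real.sqrt 3 * ‖v‖ + 3) := by
        rw [integral_const_mul]
        exact mul_le_mul_of_nonneg_left hgle pi_pos.le

/-- The transported velocities `(w, ω) ↦ v'`, `(w, ω) ↦ w'` are measurable. [folklore] -/
theorem measurable_collide_param (v : EuclideanSpace ℝ (Fin 3)) :
    Measurable (fun p : EuclideanSpace ℝ (Fin 3) × sphere (0 : EuclideanSpace ℝ (Fin 3)) 1 => (collide p.2 (v, p.1)).1) ∧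
      Measurable (fun p : EuclideanSpace ℝ (Fin 3) × sphere (0 : EuclideanSpace ℝ (Fin 3)) 1 => (collide p.2 (v, p.1)).2) := by
  constructor <;> (unfold collide; fun_prop)

/-- **The weight `‖x‖` against its Lorentz limit**: `|gainTerm ‖·‖ v - (4/3)π‖v‖²| ≤ 2π(5 + √3‖v‖)`
(`lorentzGain ‖·‖ v = (4/3)π‖v‖²`, file `…T12Lorentz`): relative error `O(1/‖v‖)`. [folklore] -/
theorem abs_gainTerm_norm_sub_lorentz (v : EuclideanSpace ℝ (Fin 3)) :
    |gainTerm (fun x => ‖x‖) v - 4 / 3 * π * ‖v‖ ^ 2| ≤ 2 * π * (5 + Real.sqrt 3 * ‖v‖) := by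
  obtain ⟨m1, m2⟩ := measurable_collide_param v
  have h1 := abs_gainPiece_norm_sub_le v m1 (fun w ω => (norm_sq_collide_le ω v w).1)
    fun w => (sphereIntegral_hardSphereKernel_mul_norm_collide_sub v w).1
  have h2 := abs_gainPiece_norm_sub_le v m2 (fun w ω => (norm_sq_collide_le ω v w).2)
    fun w => (sphereIntegral_hardSphereKernel_mul_norm_collide_sub v w).2
  rw [abs_le] at h1 h2 ⊢
  unfold gainTerm
  constructor <;> nlinarith [h1.1, h1.2, h2.1, h2.2, pi_pos]

/-! ### The weighted sup bound of the true gain term -/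

/-- **Positivity bound of one piece**: for `|u(x)| ≤ m(1 + ‖x‖)` and a measurable transported velocity `P` (`v'` or
`w'`) with `‖P‖² ≤ ‖v‖² + ‖w‖²`: `|∫ dM ∫ (u·ω)₊ u(P) dσ| ≤ m (ν(v) + ∫ dM ∫ (u·ω)₊ ‖P‖ dσ)`. [folklore] -/
theorem abs_gainPiece_le_of_linearGrowth (v : EuclideanSpace ℝ (Fin 3)) {m : ℝ} (hm : ∀ x, |u x| ≤ m * (1 + ‖x‖))
    {P : EuclideanSpace ℝ (Fin 3) × sphere (0 : EuclideanSpace ℝ (Fin 3)) 1 → EuclideanSpace ℝ (Fin 3)}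
    (hPm : Measurable P) (hP : ∀ w ω, ‖P (w, ω)‖ ^ 2 ≤ ‖v‖ ^ 2 + ‖w‖ ^ 2) :
    |∫ w, ∫ ω, hardSphereKernel (v, w) ω * u (P (w, ω)) ∂sphereMeasure ∂stdGaussian (EuclideanSpace ℝ (Fin 3))| ≤
      m * (collisionFrequency v +
        ∫ w, ∫ ω, hardSphereKernel (v, w) ω * ‖P (w, ω)‖ ∂sphereMeasure ∂stdGaussian (EuclideanSpace ℝ (Fin 3))) := by
  have hm0 : 0 ≤ m := by
    have h := hm 0
    rw [norm_zero, add_zero, mul_one] at h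
    exact (abs_nonneg _).trans h
  have hB0 : ∀ w ω, 0 ≤ hardSphereKernel (v, w) ω := fun w ω => le_max_right _ _
  obtain ⟨iN, IN⟩ := integrable_kernel_mul_comp_of_gaussGrowth (ψ := fun x : EuclideanSpace ℝ (Fin 3) => ‖x‖)
    measurable_norm abs_norm_le_exp_sq_div_four v hPm hP
  have iB : ∀ w, Integrable (fun ω => hardSphereKernel (v, w) ω)
      (sphereMeasure : Measure (sphere (0 : EuclideanSpace ℝ (Fin 3)) 1)) := fun w =>
    integrable_sphere_of_bound (by unfold hardSphereKernel; fun_prop) (K := ‖v - w‖) fun ω => by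
      rw [abs_of_nonneg (hB0 w ω)]; exact hardSphereKernel_le_norm v w ω
  have IB : Integrable (fun w => ∫ ω, hardSphereKernel (v, w) ω ∂sphereMeasure)
      (stdGaussian (EuclideanSpace ℝ (Fin 3))) := integrable_sphereIntegral_hardSphereKernel v
  -- the dominating function `g(w) = ∫ B m(1 + ‖P‖) dσ = m (∫ B + ∫ B ‖P‖)`
  set g : EuclideanSpace ℝ (Fin 3) → ℝ := fun w =>
    m * ((∫ ω, hardSphereKernel (v, w) ω ∂sphereMeasure) +
      ∫ ω, hardSphereKernel (v, w) ω * ‖P (w, ω)‖ ∂sphereMeasure) with hg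
  have hsum : ∀ w, Integrable (fun ω => hardSphereKernel (v, w) ω * (m * (1 + ‖P (w, ω)‖)))
      (sphereMeasure : Measure (sphere (0 : EuclideanSpace ℝ (Fin 3)) 1)) := fun w =>
    (((iB w).add (iN w)).const_mul m).congr (Eventually.of_forall fun ω => by
      simp only [Pi.add_apply]; ring)
  have hinner : ∀ w, ∫ ω, hardSphereKernel (v, w) ω * (m * (1 + ‖P (w, ω)‖)) ∂sphereMeasure = g w := by
    intro w
    have : (fun ω => hardSphereKernel (v, w) ω * (m * (1 + ‖P (w, ω)‖))) =
        fun ω => m * (hardSphereKernel (v, w) ω + hardSphereKernel (v, w) ω * ‖P (w, ω)‖) := by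
      funext ω; ring
    rw [this, integral_const_mul, integral_add (iB w) (iN w)]
  have hpt : ∀ w, ‖∫ ω, hardSphereKernel (v, w) ω * u (P (w, ω)) ∂sphereMeasure‖ ≤ g w := by
    intro w
    rw [← hinner w]
    refine norm_integral_le_of_norm_le (hsum w) (Eventually.of_forall fun ω => ?_)
    rw [Real.norm_eq_abs, abs_mul, abs_of_nonneg (hB0 w ω)]
    exact mul_le_mul_of_nonneg_left (hm _) (hB0 w ω)
  calc |∫ w, ∫ ω, hardSphereKernel (v, w) ω * u (P (w, ω)) ∂sphereMeasure ∂stdGaussian (EuclideanSpace ℝ (Fin 3))|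
      ≤ ∫ w, g w ∂stdGaussian (EuclideanSpace ℝ (Fin 3)) := by
        rw [← Real.norm_eq_abs]
        exact norm_integral_le_of_norm_le ((IB.add IN).const_mul m) (Eventually.of_forall hpt)
    _ = m * (collisionFrequency v +
          ∫ w, ∫ ω, hardSphereKernel (v, w) ω * ‖P (w, ω)‖ ∂sphereMeasure ∂stdGaussian (EuclideanSpace ℝ (Fin 3))) := by
        rw [hg, integral_const_mul, integral_add IB IN, collisionFrequency]

/-- **`|gainTerm u v| ≤ m (gainTerm 1 v + gainTerm ‖·‖ v)`** for `|u(x)| ≤ m(1 + ‖x‖)` (positivity of the gain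
term; no measurability of `u` is needed, a non-measurable `u` having vanishing Bochner integrals). [folklore] -/
theorem abs_gainTerm_le_of_linearGrowth {m : ℝ} (hm : ∀ x, |u x| ≤ m * (1 + ‖x‖)) (v : EuclideanSpace ℝ (Fin 3)) :
    |gainTerm u v| ≤ m * (gainTerm (fun _ => (1:ℝ)) v + gainTerm (fun x => ‖x‖) v) := by
  obtain ⟨m1, m2⟩ := measurable_collide_param v
  have h1 := abs_gainPiece_le_of_linearGrowth v hm m1 fun w ω => (norm_sq_collide_le ω v w).1
  have h2 := abs_gainPiece_le_of_linearGrowth v hm m2 fun w ω => (norm_sq_collide_le ω v w).2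
  rw [gainTerm_one]
  unfold gainTerm
  calc |(∫ w, ∫ ω, hardSphereKernel (v, w) ω * u (collide ω (v, w)).1 ∂sphereMeasure
            ∂stdGaussian (EuclideanSpace ℝ (Fin 3))) +
          ∫ w, ∫ ω, hardSphereKernel (v, w) ω * u (collide ω (v, w)).2 ∂sphereMeasure
            ∂stdGaussian (EuclideanSpace ℝ (Fin 3))|
      ≤ |∫ w, ∫ ω, hardSphereKernel (v, w) ω * u (collide ω (v, w)).1 ∂sphereMeasure
            ∂stdGaussian (EuclideanSpace ℝ (Fin 3))| +
          |∫ w, ∫ ω, hardSphereKernel (v, w) ω * u (collide ω (v, w)).2 ∂sphereMeasure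
            ∂stdGaussian (EuclideanSpace ℝ (Fin 3))| := abs_add_le _ _
    _ ≤ _ := by linarith [h1, h2]

/-- **The weighted sup bound of the true gain term**: `|u(x)| ≤ m(1 + ‖x‖)` ⟹
`|gainTerm u v| ≤ m π ((4/3)‖v‖² + 14(1 + ‖v‖))` — leading constant `(4/3)π = λ₀(1)·π` as for the Lorentz operator
(`t12_lorentzGain_abs_le`), lower order `O(m(1 + ‖v‖))`. [folklore] -/
theorem abs_gainTerm_le_weight {m : ℝ} (hm : ∀ x, |u x| ≤ m * (1 + ‖x‖)) (v : EuclideanSpace ℝ (Fin 3)) :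
    |gainTerm u v| ≤ m * π * (4 / 3 * ‖v‖ ^ 2 + 14 * (1 + ‖v‖)) := by
  have hm0 : 0 ≤ m := by
    have h := hm 0
    rw [norm_zero, add_zero, mul_one] at h
    exact (abs_nonneg _).trans h
  have h1 := (gainTerm_one_sub_lorentz v).2
  have h2 := (abs_le.1 (abs_gainTerm_norm_sub_lorentz v)).2
  have h3 : Real.sqrt 3 ≤ 2 := by
    rw [Real.sqrt_le_left (by norm_num)]; norm_num
  have hkey : gainTerm (fun _ => (1:ℝ)) v + gainTerm (fun x => ‖x‖) v ≤ π * (4 / 3 * ‖v‖ ^ 2 + 14 * (1 + ‖v‖)) := by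
    nlinarith [pi_pos, norm_nonneg v, mul_nonneg pi_pos.le (norm_nonneg v)]
  calc |gainTerm u v| ≤ m * (gainTerm (fun _ => (1:ℝ)) v + gainTerm (fun x => ‖x‖) v) :=
        abs_gainTerm_le_of_linearGrowth hm v
    _ ≤ m * (π * (4 / 3 * ‖v‖ ^ 2 + 14 * (1 + ‖v‖))) := mul_le_mul_of_nonneg_left hkey hm0
    _ = m * π * (4 / 3 * ‖v‖ ^ 2 + 14 * (1 + ‖v‖)) := by ring

/-! ### Registered helpers -/

/-- **Registered helper `t12_gainTerm_norm_sub_lorentz` — the true gain term on the linear radial weight against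
its far-field (Lorentz) limit.** For every `v ∈ ℝ³` (`M = stdGaussian`, `σ` the surface measure of `S²`,
`(v', w') = collide ω (v, w)`):
`|∫ dM(w) ∫_{S²} ((v-w)·ω)₊ ‖v'‖ dσ(ω) + ∫ dM(w) ∫_{S²} ((v-w)·ω)₊ ‖w'‖ dσ(ω) - (4/3)π‖v‖²| ≤ 2π(5 + √3‖v‖)`,
i.e. `K₂‖·‖(v) = lorentzGain ‖·‖ v + O(1 + ‖v‖)` with `lorentzGain ‖·‖ v = (4/3)π‖v‖²` (`…T12Lorentz`): thermal
smearing of the partner moves the first radial moment of the gain kernel by a RELATIVE `O(1/‖v‖)` only.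
Mechanism: per partner `w` the circle averages are exact, `∫ (u·ω)₊ ‖v' - w‖ dσ = ∫ (u·ω)₊ ‖w' - w‖ dσ = (2/3)π‖v-w‖²`
(radius law `2ρ dρ`), `|‖v'‖ - ‖v' - w‖| ≤ ‖w‖`, and `∫‖v-w‖² dM = ‖v‖² + 3`, `∫‖w‖ dM ≤ √3`. The regularity-free
part of FF1 of the corrector-growth plan (comparison on the positive cone of radial weights). [folklore] -/
theorem t12_gainTerm_norm_sub_lorentz : ∀ v : EuclideanSpace ℝ (Fin 3), |(∫ w, ∫ ω, Literature.MathematicalPhysics.KineticTheory.hardSphereKernel (v, w) ω * ‖(Literature.MathematicalPhysics.KineticTheory.collide ω (v, w)).1‖ ∂Literature.MathematicalPhysics.KineticTheory.sphereMeasure ∂ProbabilityTheory.stdGaussian (EuclideanSpace ℝ (Fin 3))) + (∫ w, ∫ ω, Literature.MathematicalPhysics.KineticTheory.hardSphereKernel (v, w) ω * ‖(Literature.MathematicalPhysics.KineticTheory.collide ω (v, w)).2‖ ∂Literature.MathematicalPhysics.KineticTheory.sphereMeasure ∂ProbabilityTheory.stdGaussian (EuclideanSpace ℝ (Fin 3)))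 - 4 / 3 * Real.pi * ‖v‖ ^ 2| ≤ 2 * Real.pi * (5 + Real.sqrt 3 * ‖v‖) :=
  fun v => abs_gainTerm_norm_sub_lorentz v

/-- **Registered helper `t12_gainTerm_abs_le_of_linearGrowth` — the weighted sup bound of the true gain term.**
For `u : ℝ³ → ℝ` with `|u(x)| ≤ m(1 + ‖x‖)` and every `v`:
`|∫ dM(w) ∫_{S²} ((v-w)·ω)₊ u(v') dσ(ω) + ∫ dM(w) ∫_{S²} ((v-w)·ω)₊ u(w') dσ(ω)| ≤ m π ((4/3)‖v‖² + 14(1 + ‖v‖))`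
(`(v', w') = collide ω (v, w)`, `M = stdGaussian`): by positivity `|K₂u| ≤ m(K₂1 + K₂‖·‖) = m(2ν + K₂‖·‖)`, with
`ν(v) ≤ π(‖v‖ + √3)` and `t12_gainTerm_norm_sub_lorentz`. The leading constant `(4/3)π = λ₀(1)·π` is that of the
far-field operator (`t12_lorentzGain_abs_le`: `π‖v‖m(2 + (4/3)‖v‖)`); with `ν ≥ π‖v‖` this is the one-step norm
`‖ν⁻¹K₂‖ ≤ 4/3 + O(1/s₀)` on `sup|u|/(1+‖v‖)`, `‖v‖ ≥ s₀`, for the data terms of THE SCHEME (plan §6). [folklore] -/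
theorem t12_gainTerm_abs_le_of_linearGrowth : ∀ (u : EuclideanSpace ℝ (Fin 3) → ℝ) (m : ℝ), (∀ x, |u x| ≤ m * (1 + ‖x‖)) → ∀ v : EuclideanSpace ℝ (Fin 3), |(∫ w, ∫ ω, Literature.MathematicalPhysics.KineticTheory.hardSphereKernel (v, w) ω * u (Literature.MathematicalPhysics.KineticTheory.collide ω (v, w)).1 ∂Literature.MathematicalPhysics.KineticTheory.sphereMeasure ∂ProbabilityTheory.stdGaussian (EuclideanSpace ℝ (Fin 3))) + (∫ w, ∫ ω, Literature.MathematicalPhysics.KineticTheory.hardSphereKernel (v, w) ω * u (Literature.MathematicalPhysics.KineticTheory.collide ω (v, w)).2 ∂Literature.MathematicalPhysics.KineticTheory.sphereMeasure ∂ProbabilityTheory.stdGaussian (EuclideanSpace ℝ (Fin 3)))| ≤ m * Real.pi * (4 / 3 * ‖v‖ ^ 2 + 14 * (1 + ‖v‖)) :=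
  fun _ _ hm v => abs_gainTerm_le_weight hm v

end Summit.AtomisticToContinuum.HydrodynamicLimit.Theorems.ClampedCorrectorBirth

end
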